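import Summits.CriticalPhenomena.Ising3D.ExclusionSentencesTrg
import Summits.CriticalPhenomena.Ising3D.ExclusionSentencesGamma

/-!
# Exclusion sentences — the `Γ(¼)` / `Γ(⅓)` monomials of family `TRG` in kernel form: the whole FAMILIES-v1
table is now kernel-checkable (cell `pub-ising3x`, seat recog-1)

HONEST FRAMING: lottery ticket; floor = tightest certified 3D Ising CFT bounds; no exact-solution
claim without a proof.

FAMILIES-v1 `TRG` (`HOME/frozen/FAMILIES-v1.json`, SCOPE.md §3.1): `x = (p/q)·u·π^(a/2)·Γ(¼)^b·Γ(⅓)^c·L^s`,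
`u ∈ {1, √2, √3}`, `a ∈ [−6, 6]`, `(b ∈ [−4, 4], c = 0)` or `(b = 0, c ∈ [−3, 3])`, `L ∈ {log 2, ζ(3), ζ(5), G, e}`,
`s ∈ {−1, 0, 1}`, `(a, b, c, s) ≠ 0`, `1 ≤ p, q ≤ h`, grading `D = |a| + 2|b| + 2|c| + 2|s| + [u ≠ 1]`.
`ExclusionSentencesTrg.lean` covers `b = c = 0`; with `gamma_quarter_mem` / `gamma_third_mem`
(`ExclusionSentencesGamma.lean`) this file covers the rest.  The pair `(b, c)` is coded as `(g, b)`: `g = 0` means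
the factor `Γ(¼)^b`, `g = 1` means `Γ(⅓)^b` (so FAMILIES-v1's `c` is our `b` when `g = 1`); `b = 0` is the
`Γ`-free part (either `g`).
* `trgGVal u a g b L s = trgLVal u a L s · Γ_g^b`, `trgFullFamily D h` (ALL of TRG; `p/q` need not be reduced —
  a superset), tuples `(p, q, u, a, g, b, L, s)` with value `trgGTupleVal`;
* checker for ONE `Γ`-exponent class `trgGExcludedGB D h g b lo hi ex` (≈ one `TRG` sentence of kernel time,
  ≈ 16 s at `h = 32`), the whole-table checker `trgFullExcluded D h lo hi ex` (= the `b ∈ [−4, 4]` classes of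
  `g = 0` and the `b ∈ [−3, 3] ∖ {0}` classes of `g = 1`) and `trgFullExcluded_of_parts` assembling it from
  EIGHT separately stated part theorems `trgFullPart D h k lo hi ex = true` (`k = 0..7`, two classes each:
  one kernel evaluation of all fifteen classes does not fit in one declaration);
* **`trgFullExcluded_sound`**: every member of `trgFullFamily D h` in `[lo, hi]` equals a listed tuple's value;
  bridges `sigma/eps_trgFull_covered_of_isingEnclosure`.
Measured kernel cost: ≈ 17 s per `(g, b)` class at `h = 32` (429 monomials × `q ≤ 32`), so a part ≈ 34 s and
the whole table ≈ 4.3 min spread over eight declarations.  Python twin (same enclosures and loops):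
`HOME/pub-ising3x-recog-1/lean/tools/trg_gamma_exceptions.py`.  No 3D digit is used; instances live in
`ExclusionSentencesControl2DTrgGamma.lean` / `…TrgGammaFin.lean`.
-/

namespace Summit.CriticalPhenomena.Ising3D

open Literature.MathematicalPhysics.QuantumFieldTheory.ConformalBootstrap3D

/-- Enclosure of `Γ_g` (`g = 0`: `Γ(¼)`; otherwise `Γ(⅓)`). -/
def gamI : ℕ → ℚ × ℚ
  | 0 => gammaQuarterI
  | _ => gammaThirdI

/-- The value `Γ_g` (`g = 0`: `Γ(¼)`; otherwise `Γ(⅓)`). -/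
noncomputable def gamVal : ℕ → ℝ
  | 0 => Real.Gamma (1 / 4)
  | _ => Real.Gamma (1 / 3)

/-- Soundness of `gamI`, and positivity of both ends. -/
theorem gamVal_mem (g : ℕ) : gamVal g ∈ InI (gamI g) ∧ 0 < (gamI g).1 ∧ 0 < (gamI g).2 := by
  match g with
  | 0 => exact ⟨gamma_quarter_mem, by norm_num [gamI, gammaQuarterI], by norm_num [gamI, gammaQuarterI]⟩
  | n + 1 => exact ⟨gamma_third_mem, by norm_num [gamI, gammaThirdI], by norm_num [gamI, gammaThirdI]⟩

/-- The full TRG monomial `u · (√π)^a · L^s · Γ_g^b`. -/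
noncomputable def trgGVal (u : ℕ) (a : ℤ) (g : ℕ) (b : ℤ) (L : ℕ) (s : ℤ) : ℝ :=
  trgLVal u a L s * gamVal g ^ b

/-- Rational enclosure of `trgGVal`. -/
def trgGEncl (u : ℕ) (a : ℤ) (g : ℕ) (b : ℤ) (L : ℕ) (s : ℤ) : ℚ × ℚ :=
  mulI (trgLEncl u a L s) (zpowI (gamI g) b)

/-- Soundness of `trgGEncl`, and positivity of its lower end. -/
theorem trgGVal_mem (u : ℕ) (a : ℤ) (g : ℕ) (b : ℤ) (L : ℕ) (s : ℤ) :
    trgGVal u a g b L s ∈ InI (trgGEncl u a g b L s) ∧ 0 < (trgGEncl u a g b L s).1 := by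
  obtain ⟨hm, hm0⟩ := trgLVal_mem u a L s
  obtain ⟨hg, hg1, hg2⟩ := gamVal_mem g
  have h2 := zpowI_sound hg1 hg b
  have h2p := zpowI_pos hg1 hg2 b
  refine ⟨mulI_sound hm0.le h2p.le hm h2, ?_⟩
  simp only [trgGEncl, mulI]
  exact mul_pos hm0 h2p

/-- `trgFullFamily D h` = ALL of FAMILIES-v1 `TRG`: `(p/q)·u·π^(a/2)·Γ_g^b·L^s` with `g = 0, |b| ≤ 4` (`Γ(¼)`) or
`g = 1, |b| ≤ 3` (`Γ(⅓)`), `a ∈ [−6, 6]`, `L ≤ 4`, `|s| ≤ 1`, `(a, b, s) ≠ 0`, `1 ≤ p, q ≤ h`,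
`|a| + 2|b| + 2|s| + [u ≠ 1] ≤ D`. -/
def trgFullFamily (D h : ℕ) : Set ℝ :=
  {x | ∃ (p q u L g : ℕ) (a b s : ℤ), 1 ≤ p ∧ p ≤ h ∧ 1 ≤ q ∧ q ≤ h ∧ u ≤ 2 ∧ L ≤ 4 ∧ g ≤ 1 ∧
    -6 ≤ a ∧ a ≤ 6 ∧ -(4 - (g : ℤ)) ≤ b ∧ b ≤ 4 - (g : ℤ) ∧ -1 ≤ s ∧ s ≤ 1 ∧ (a ≠ 0 ∨ b ≠ 0 ∨ s ≠ 0) ∧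
    a.natAbs + 2 * b.natAbs + 2 * s.natAbs + (if u = 0 then 0 else 1) ≤ D ∧
    x = (p : ℝ) / q * trgGVal u a g b L s}

/-- The `Γ`-free family is the `b = 0` slice: `trgFamily D h ⊆ trgFullFamily D h`. -/
theorem trgFamily_subset_trgFullFamily (D h : ℕ) : trgFamily D h ⊆ trgFullFamily D h := by
  rintro x ⟨p, q, u, L, a, s, hp1, hph, hq1, hqh, hu, hL, ha1, ha2, hs1, hs2, hne, hD, rfl⟩
  refine ⟨p, q, u, L, 0, a, 0, s, hp1, hph, hq1, hqh, hu, hL, by omega, ha1, ha2, by omega, by omega, hs1, hs2,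
    by omega, by simpa using hD, ?_⟩
  simp [trgGVal]

/-- A listed full-TRG tuple `(p, q, u, a, g, b, L, s)` and its value. -/
noncomputable def trgGTupleVal (e : ℕ × ℕ × ℕ × ℤ × ℕ × ℤ × ℕ × ℤ) : ℝ :=
  (e.1 : ℝ) / e.2.1 * trgGVal e.2.2.1 e.2.2.2.1 e.2.2.2.2.1 e.2.2.2.2.2.1 e.2.2.2.2.2.2.1 e.2.2.2.2.2.2.2

/-- One `(p, q)` candidate for a fixed monomial with enclosure `m`: decidably outside `[lo, hi]`, or listed
with the same monomial and `p·q′ = p′·q`. -/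
def trgGCandOK (lo hi : ℚ) (ex : List (ℕ × ℕ × ℕ × ℤ × ℕ × ℤ × ℕ × ℤ)) (u : ℕ) (av : ℤ) (g : ℕ) (b : ℤ)
    (L : ℕ) (s : ℤ) (m : ℚ × ℚ) (q : ℕ) (p : ℤ) : Bool :=
  decide ((p : ℚ) / q * m.2 < lo) || decide (hi < (p : ℚ) / q * m.1) ||
    ex.any fun e => decide (0 < e.2.1 ∧ e.2.2.1 = u ∧ e.2.2.2.1 = av ∧ e.2.2.2.2.1 = g ∧ e.2.2.2.2.2.1 = b ∧
      e.2.2.2.2.2.2.1 = L ∧ e.2.2.2.2.2.2.2 = s ∧ p * (e.2.1 : ℤ) = (e.1 : ℤ) * q)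

/-- The checker for ONE `Γ`-exponent class `(g, b)`: loops `u ≤ 2`, `a ∈ [−6, 6]`, `L ≤ 4`, `s ∈ [−1, 1]`
(skipping `(a, b, s) = 0`, the `s = 0, L ≠ 0` duplicates and tuples above the complexity bound), `q ≤ h`,
`p` in the candidate range of the monomial enclosure. -/
def trgGExcludedGB (D h : ℕ) (g : ℕ) (b : ℤ) (lo hi : ℚ) (ex : List (ℕ × ℕ × ℕ × ℤ × ℕ × ℤ × ℕ × ℤ)) : Bool :=
  (List.range 3).all fun u =>
    allIntIcc (-6) 6 fun av =>
      (List.range 5).all fun L =>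
        allIntIcc (-1) 1 fun s =>
          decide (av = 0 ∧ b = 0 ∧ s = 0) || decide (s = 0 ∧ 0 < L) ||
            !decide (av.natAbs + 2 * b.natAbs + 2 * s.natAbs + (if u = 0 then 0 else 1) ≤ D) ||
            (List.range' 1 h).all fun q =>
              allIntIcc (max 1 ⌈lo * q / (trgGEncl u av g b L s).2⌉)
                (min (h : ℤ) ⌊hi * q / (trgGEncl u av g b L s).1⌋)
                (trgGCandOK lo hi ex u av g b L s (trgGEncl u av g b L s) q)

/-- Soundness of one class: a member of that `(g, b)` class (with the normalisation `s = 0 → L = 0`) in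
`[lo, hi]` is listed. -/
theorem trgGExcludedGB_sound {D h g : ℕ} {b : ℤ} {lo hi : ℚ} {ex : List (ℕ × ℕ × ℕ × ℤ × ℕ × ℤ × ℕ × ℤ)}
    (hc : trgGExcludedGB D h g b lo hi ex = true) {p q u L : ℕ} {av s : ℤ}
    (hp1 : 1 ≤ p) (hph : p ≤ h) (hq1 : 1 ≤ q) (hqh : q ≤ h) (hu : u ≤ 2) (hL : L ≤ 4)
    (ha1 : -6 ≤ av) (ha2 : av ≤ 6) (hs1 : -1 ≤ s) (hs2 : s ≤ 1) (hne : av ≠ 0 ∨ b ≠ 0 ∨ s ≠ 0)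
    (hskip : ¬(s = 0 ∧ 0 < L)) (hD : av.natAbs + 2 * b.natAbs + 2 * s.natAbs + (if u = 0 then 0 else 1) ≤ D)
    (hx : (lo : ℝ) ≤ (p : ℝ) / q * trgGVal u av g b L s ∧ (p : ℝ) / q * trgGVal u av g b L s ≤ hi) :
    ∃ e ∈ ex, (p : ℝ) / q * trgGVal u av g b L s = trgGTupleVal e := by
  obtain ⟨⟨hm1, hm2⟩, hm0⟩ := trgGVal_mem u av g b L s
  set m := trgGEncl u av g b L s with hm
  have hm0' : (0 : ℝ) < m.1 := by exact_mod_cast hm0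
  have hq0 : (0 : ℝ) < q := by exact_mod_cast hq1
  have hpq0 : (0 : ℝ) < (p : ℝ) / q := by positivity
  unfold trgGExcludedGB at hc
  have h1 := List.all_eq_true.mp hc u (List.mem_range.mpr (by omega))
  have h2 := allIntIcc_sound h1 ha1 ha2
  have h3 := List.all_eq_true.mp h2 L (List.mem_range.mpr (by omega))
  have h4 := allIntIcc_sound h3 hs1 hs2
  simp only [Bool.or_eq_true, decide_eq_true_eq, Bool.not_eq_true', decide_eq_false_iff_not] at h4
  rcases h4 with ((h4 | h4) | h4) | h4
  · omega
  · exact absurd h4 hskip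
  · exact absurd hD h4
  · have h5 := List.all_eq_true.mp h4 q (List.mem_range'_1.mpr ⟨hq1, by omega⟩)
    have hlo : max 1 ⌈lo * q / m.2⌉ ≤ (p : ℤ) := by
      refine max_le (by exact_mod_cast hp1) ?_
      have hm2q : (0 : ℚ) < m.2 := by
        have : (m.1 : ℝ) ≤ m.2 := hm1.trans hm2
        exact lt_of_lt_of_le hm0 (by exact_mod_cast this)
      rw [Int.ceil_le, div_le_iff₀ hm2q]
      have : (lo : ℝ) * q ≤ p * m.2 := by
        have h' : (p : ℝ) / q * trgGVal u av g b L s ≤ p / q * m.2 := mul_le_mul_of_nonneg_left hm2 hpq0.le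
        calc (lo : ℝ) * q ≤ p / q * m.2 * q := mul_le_mul_of_nonneg_right (hx.1.trans h') hq0.le
          _ = p * m.2 := by field_simp
      exact_mod_cast this
    have hhi : (p : ℤ) ≤ min (h : ℤ) ⌊hi * q / m.1⌋ := by
      refine le_min (by exact_mod_cast hph) ?_
      rw [Int.le_floor, le_div_iff₀ hm0]
      have : (p : ℝ) * m.1 ≤ hi * q := by
        have h' : (p : ℝ) / q * m.1 ≤ p / q * trgGVal u av g b L s := mul_le_mul_of_nonneg_left hm1 hpq0.le
        calc (p : ℝ) * m.1 = p / q * m.1 * q := by field_simp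
          _ ≤ hi * q := mul_le_mul_of_nonneg_right (h'.trans hx.2) hq0.le
      exact_mod_cast this
    have h6 := allIntIcc_sound h5 hlo hhi
    unfold trgGCandOK at h6
    simp only [Bool.or_eq_true, decide_eq_true_eq, List.any_eq_true] at h6
    rcases h6 with (h6 | h6) | ⟨e, he, hkey⟩
    · exfalso
      have h7 : (((p : ℚ) / q * m.2 : ℚ) : ℝ) < (lo : ℝ) := Rat.cast_lt.mpr h6
      push_cast at h7
      linarith [mul_le_mul_of_nonneg_left hm2 hpq0.le, hx.1]
    · exfalso
      have h7 : ((hi : ℚ) : ℝ) < (((p : ℚ) / q * m.1 : ℚ) : ℝ) := Rat.cast_lt.mpr h6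
      push_cast at h7
      linarith [mul_le_mul_of_nonneg_left hm1 hpq0.le, hx.2]
    · obtain ⟨he0, heu, hea, heg, heb, heL, hes, hpq⟩ := hkey
      refine ⟨e, he, ?_⟩
      unfold trgGTupleVal
      rw [heu, hea, heg, heb, heL, hes]
      have he2 : (0 : ℝ) < e.2.1 := by exact_mod_cast he0
      have hpq' : (p : ℝ) * e.2.1 = e.1 * q := by exact_mod_cast hpq
      congr 1
      rw [div_eq_div_iff hq0.ne' he2.ne']
      exact hpq'

/-- The whole-table checker: every `(g, b)` class (`g = 0`: `b ∈ [−4, 4]`; `g = 1`: `b ∈ [−3, 3]`, `b ≠ 0`). -/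
def trgFullExcluded (D h : ℕ) (lo hi : ℚ) (ex : List (ℕ × ℕ × ℕ × ℤ × ℕ × ℤ × ℕ × ℤ)) : Bool :=
  (allIntIcc (-4) 4 fun b => trgGExcludedGB D h 0 b lo hi ex) &&
    (allIntIcc (-3) 3 fun b => decide (b = 0) || trgGExcludedGB D h 1 b lo hi ex)

/-- **Soundness of the full TRG sentence.** If `trgFullExcluded D h lo hi ex = true` then every member of
`trgFullFamily D h` in `[lo, hi]` equals the value of a listed tuple. -/
theorem trgFullExcluded_sound {D h : ℕ} {lo hi : ℚ} {ex : List (ℕ × ℕ × ℕ × ℤ × ℕ × ℤ × ℕ × ℤ)}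
    (hc : trgFullExcluded D h lo hi ex = true) {x : ℝ} (hx : (lo : ℝ) ≤ x ∧ x ≤ hi)
    (hmem : x ∈ trgFullFamily D h) : ∃ e ∈ ex, x = trgGTupleVal e := by
  obtain ⟨p, q, u, L₀, g₀, av, b, s, hp1, hph, hq1, hqh, hu, hL₀, hg₀, ha1, ha2, hb1, hb2, hs1, hs2, hne, hD, rfl⟩ :=
    hmem
  -- normalise `L` (irrelevant when `s = 0`) and `g` (irrelevant when `b = 0`)
  obtain ⟨L, hL, hskip, hvalL⟩ : ∃ L, L ≤ 4 ∧ ¬(s = 0 ∧ 0 < L) ∧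
      trgGVal u av g₀ b L₀ s = trgGVal u av g₀ b L s := by
    by_cases hs : s = 0
    · exact ⟨0, by omega, by omega, by simp [trgGVal, trgLVal, hs]⟩
    · exact ⟨L₀, hL₀, by omega, rfl⟩
  obtain ⟨g, hg, hgb, hvalG⟩ : ∃ g : ℕ, g ≤ 1 ∧ ¬(b = 0 ∧ g = 1) ∧ (-(4 - (g : ℤ)) ≤ b ∧ b ≤ 4 - (g : ℤ)) ∧
      trgGVal u av g₀ b L s = trgGVal u av g b L s := by
    by_cases hb : b = 0
    · exact ⟨0, by omega, by omega, by omega, by simp [trgGVal, hb]⟩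
    · exact ⟨g₀, hg₀, by omega, ⟨hb1, hb2⟩, rfl⟩
  rw [hvalL, hvalG.2] at hx ⊢
  obtain ⟨hb1', hb2'⟩ := hvalG.1
  unfold trgFullExcluded at hc
  rw [Bool.and_eq_true] at hc
  have hclass : trgGExcludedGB D h g b lo hi ex = true := by
    interval_cases g
    · exact allIntIcc_sound hc.1 (by omega) (by omega)
    · have := allIntIcc_sound hc.2 (by omega : (-3 : ℤ) ≤ b) (by omega)
      simp only [Bool.or_eq_true, decide_eq_true_eq] at this
      rcases this with this | this
      · omega
      · exact this
  exact trgGExcludedGB_sound hclass hp1 hph hq1 hqh hu hL ha1 ha2 hs1 hs2 hne hskip hD hx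

/-- Part `k` of `trgFullExcluded` (`k = 0..7`; two classes each, one kernel evaluation ≈ two `TRG` sentences):
`k = 0..3`: `g = 0`, `b ∈ {2k−4, 2k−3}`; `k = 4`: `g = 0`, `b = 4` and `g = 1`, `b = −3`; `k = 5`: `g = 1`,
`b ∈ {−2, −1}`; `k = 6`: `g = 1`, `b ∈ {1, 2}`; `k = 7`: `g = 1`, `b = 3`. -/
def trgFullPart (D h k : ℕ) (lo hi : ℚ) (ex : List (ℕ × ℕ × ℕ × ℤ × ℕ × ℤ × ℕ × ℤ)) : Bool :=
  match k with
  | 0 => trgGExcludedGB D h 0 (-4) lo hi ex && trgGExcludedGB D h 0 (-3) lo hi ex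
  | 1 => trgGExcludedGB D h 0 (-2) lo hi ex && trgGExcludedGB D h 0 (-1) lo hi ex
  | 2 => trgGExcludedGB D h 0 0 lo hi ex && trgGExcludedGB D h 0 1 lo hi ex
  | 3 => trgGExcludedGB D h 0 2 lo hi ex && trgGExcludedGB D h 0 3 lo hi ex
  | 4 => trgGExcludedGB D h 0 4 lo hi ex && trgGExcludedGB D h 1 (-3) lo hi ex
  | 5 => trgGExcludedGB D h 1 (-2) lo hi ex && trgGExcludedGB D h 1 (-1) lo hi ex
  | 6 => trgGExcludedGB D h 1 1 lo hi ex && trgGExcludedGB D h 1 2 lo hi ex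
  | _ => trgGExcludedGB D h 1 3 lo hi ex

/-- Assemble `trgFullExcluded` from its eight parts (each hypothesis = a separately stated theorem). -/
theorem trgFullExcluded_of_parts {D h : ℕ} {lo hi : ℚ} {ex : List (ℕ × ℕ × ℕ × ℤ × ℕ × ℤ × ℕ × ℤ)}
    (h0 : trgFullPart D h 0 lo hi ex = true) (h1 : trgFullPart D h 1 lo hi ex = true)
    (h2 : trgFullPart D h 2 lo hi ex = true) (h3 : trgFullPart D h 3 lo hi ex = true)
    (h4 : trgFullPart D h 4 lo hi ex = true) (h5 : trgFullPart D h 5 lo hi ex = true)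
    (h6 : trgFullPart D h 6 lo hi ex = true) (h7 : trgFullPart D h 7 lo hi ex = true) :
    trgFullExcluded D h lo hi ex = true := by
  simp only [trgFullPart, Bool.and_eq_true] at h0 h1 h2 h3 h4 h5 h6 h7
  unfold trgFullExcluded allIntIcc
  simp only [Bool.and_eq_true, List.all_eq_true, List.mem_range, Bool.or_eq_true, decide_eq_true_eq]
  refine ⟨fun i hi => ?_, fun i hi => ?_⟩
  · have hi' : i < 9 := by simpa using hi
    interval_cases i
    · exact h0.1
    · exact h0.2
    · exact h1.1
    · exact h1.2
    · exact h2.1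
    · exact h2.2
    · exact h3.1
    · exact h3.2
    · exact h4.1
  · have hi' : i < 7 := by simpa using hi
    interval_cases i
    · exact Or.inr h4.2
    · exact Or.inr h5.1
    · exact Or.inr h5.2
    · exact Or.inl rfl
    · exact Or.inr h6.1
    · exact Or.inr h6.2
    · exact Or.inr h7

/-! ### Bridges from the floor's statements -/

/-- **Full TRG sentence for `Δ_σ`.** -/
theorem sigma_trgFull_covered_of_isingEnclosure {W R : Set (ℝ × ℝ)} (h : IsingEnclosure W R) {a b : ℚ}
    (hR : ∀ q ∈ R, (a : ℝ) ≤ q.1 ∧ q.1 ≤ b) {Dm hh : ℕ} {ex : List (ℕ × ℕ × ℕ × ℤ × ℕ × ℤ × ℕ × ℤ)}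
    (hx : trgFullExcluded Dm hh a b ex = true) (D : SigmaEpsilonData) (hD : D.SatisfiesBootstrapAxioms)
    (hW : (D.Δσ, D.Δε) ∈ W) (hmem : D.Δσ ∈ trgFullFamily Dm hh) : ∃ e ∈ ex, D.Δσ = trgGTupleVal e :=
  trgFullExcluded_sound hx (hR _ (h D hD hW)) hmem

/-- **Full TRG sentence for `Δ_ε`.** -/
theorem eps_trgFull_covered_of_isingEnclosure {W R : Set (ℝ × ℝ)} (h : IsingEnclosure W R) {a b : ℚ}
    (hR : ∀ q ∈ R, (a : ℝ) ≤ q.2 ∧ q.2 ≤ b) {Dm hh : ℕ} {ex : List (ℕ × ℕ × ℕ × ℤ × ℕ × ℤ × ℕ × ℤ)}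
    (hx : trgFullExcluded Dm hh a b ex = true) (D : SigmaEpsilonData) (hD : D.SatisfiesBootstrapAxioms)
    (hW : (D.Δσ, D.Δε) ∈ W) (hmem : D.Δε ∈ trgFullFamily Dm hh) : ∃ e ∈ ex, D.Δε = trgGTupleVal e :=
  trgFullExcluded_sound hx (hR _ (h D hD hW)) hmem

end Summit.CriticalPhenomena.Ising3D
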